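/-
Copyright (c) 2026 the pub-hodgecm-mathlib formalisation cell (harness21).  Prover seat hodgecm-mathlib-K2Liu-p09 (g3): Track B «K2-LIT», #184♮ = hLiu418,
payer-internal organ (an) «ANISOTROPY OF `H` FROM s23's SIGN DATA» of file #34 `Theorems/K2LiuDoublingZetaGL1.lean` (LEAD F0P6-plan (g10) DEAL K2/STATUS
2026-09-04T02:36:29Z; REPORT-FIRST #34 v3, K2/K2Liu-p09/g3; DEPMAP v2.7 §8 (an) ∕ §10 TABLE A rows «definiteness elsewhere», «degree»).
-/
import Literature.NumberTheory.Automorphic.AdelicUnitaryGroupDatum        -- ★ `anisotropic_of_posDef_map`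
import Literature.NumberTheory.Automorphic.ArchCongruenceTransport         -- ★ `anisotropic_formCongr`, `formCongr_inv_formCongr`
import Literature.NumberTheory.Automorphic.UnitaryGroupFrameEmbedding       -- ★ `hermForm_smul_matrix`
import HarnessLib

/-!
# Crux `HLiu418`, Track B road `K2_Liu`, file #34 — organ (an) «`H` IS ANISOTROPIC»: ★ #13's binder `_hanis` FROM s23's BINDERS `hg`, `hpos`, `4 ≤ [L:ℚ]`

Cell `hodgecm-mathlib`, crux item hLiu418 = `stmt-HodgeConjecture-24832`, route of record `HCCMUnconditional`; squad K2 ∕ K2Liu, prover K2Liu-p09 (g3).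
THEOREMS ONLY (no `def`, no instance, no notation, no named-fact hypothesis, no `sorry`, default heartbeats); lane
`--supports stmt-HodgeConjecture-24832 --as helper` (count-neutral).

★ #13 `sig_K2LiuDoublingUnfold` (p855244) binds `_hanis : ∀ x, hermForm (cmConjRingHom L) H x x = 0 → x = 0`; s23 `DoublingZetaGL1` does not carry it
(DEPMAP §8 (an) reads anisotropy off the `CompactSpace` instances, which is the converse direction).  It IS derivable from s23's own binders:
`[L:ℚ] ≥ 4` gives a complex place `τ' ≠ ι` of the CM field `L` (`#places = [L:ℚ]∕2 ≥ 2`, Mathlib `card_add_two_mul_card_eq_rank`,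
`IsTotallyComplex.nrRealPlaces_eq_zero`), where `diag(dV)` is positive definite (`hpos`), hence `diag(dV) = c(g)ᵀ (t•H) g` is anisotropic over `L`
(★ `anisotropic_of_posDef_map`), hence so are `t • H` (★ `formCongr_inv_formCongr` + ★ `anisotropic_formCongr`) and `H` (★ `hermForm_smul_matrix`; `t = 0` is harmless here).

HONEST LABEL: HC_CM is proved only modulo the printed citations (2 remaining named inputs: hLiu418 = stmt-HodgeConjecture-24832,
h413 = stmt-HodgeConjecture-24833) until rung 0 closes; this file is bookkeeping toward socket s23 and closes no item.
References: [PlatonovRapinchuk1994] §2.3; [Rogawski1990] §14.1 p. 232; Neukirch, *ANT* Ch. III §1 (places of a CM field).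
-/

set_option autoImplicit false
set_option linter.dupNamespace false

noncomputable section

open scoped Matrix ComplexOrder
open NumberField NumberField.InfinitePlace Module
open Literature.NumberTheory.Automorphic Literature.NumberTheory.Automorphic.UnitaryGroup

namespace Summit.HodgeConjecture.HodgeConjecture.Cruxes.HLiu418.K2LiuDoublingZetaGL1Anisotropic

variable (L : Type) [Field L] [NumberField L] [IsCMField L]

/-- **a CM field of degree `≥ 4` has a complex place other than any given one** (`#places(L) = [L:ℚ]∕2`). [folklore] -/
theorem exists_embedding_mk_ne (h4L : 4 ≤ finrank ℚ L) (ι : L →+* ℂ) : ∃ τ' : L →+* ℂ, InfinitePlace.mk τ' ≠ InfinitePlace.mk ι := by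
  by_contra hall
  have hall' : ∀ τ' : L →+* ℂ, InfinitePlace.mk τ' = InfinitePlace.mk ι := fun τ' => not_ne_iff.1 (not_exists.1 hall τ')
  have hcard : Fintype.card (InfinitePlace L) = 1 :=
    Fintype.card_eq_one_iff.2 ⟨InfinitePlace.mk ι, fun w => by rw [← mk_embedding w]; exact hall' _⟩
  have h1 := card_eq_nrRealPlaces_add_nrComplexPlaces L
  have h2 := card_add_two_mul_card_eq_rank L
  rw [IsTotallyComplex.nrRealPlaces_eq_zero] at h1 h2
  omega

/-- anisotropy descends along a congruence: if `c(P)ᵀ J P` is anisotropic then so is `J` (★ `formCongr_inv_formCongr` + ★ `anisotropic_formCongr`).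
[cite: PlatonovRapinchuk1994, §2.3] -/
theorem anisotropic_of_anisotropic_formCongr {N : ℕ} (P : GL (Fin N) L) {J : Matrix (Fin N) (Fin N) L}
    (h : ∀ x : Fin N → L, hermForm (cmConjRingHom L) (formCongr (cmConjRingHom L) P J) x x = 0 → x = 0) :
    ∀ x : Fin N → L, hermForm (cmConjRingHom L) J x x = 0 → x = 0 := by
  have key := anisotropic_formCongr (cmConjRingHom L) P⁻¹ h
  rwa [formCongr_inv_formCongr] at key

/-- anisotropy is insensitive to a scalar: `t • H` anisotropic ⇒ `H` anisotropic (★ `hermForm_smul_matrix`). [cite: PlatonovRapinchuk1994, §2.3] -/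
theorem anisotropic_of_anisotropic_smul {N : ℕ} (t : L) {H : Matrix (Fin N) (Fin N) L}
    (h : ∀ x : Fin N → L, hermForm (cmConjRingHom L) (t • H) x x = 0 → x = 0) :
    ∀ x : Fin N → L, hermForm (cmConjRingHom L) H x x = 0 → x = 0 := fun x hx =>
  h x (by rw [hermForm_smul_matrix, hx, mul_zero])

/-- **ORGAN (an) OF #34 — ★ #13's `_hanis` FROM s23's BINDERS.**  In s23's frame (`hg : c(g)ᵀ (t • H) g = diag(dV)`) with s23's sign data
(`hpos`: `diag(dV)` positive definite at every complex embedding off the place of `ι`) and `4 ≤ [L:ℚ]`, the hermitian matrix `H` is ANISOTROPIC over `L`.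
[cite: PlatonovRapinchuk1994, §2.3] [cite: Rogawski1990, §14.1 p. 232] -/
theorem anisotropic_of_seam (ι : L →+* ℂ) (H : Matrix (Fin 2) (Fin 2) L) (dV : Fin 2 → L) (t : L) (g : GL (Fin 2) L)
    (hg : formCongr ((IsCMField.complexConj L : L ≃ₐ[↥(maximalRealSubfield L)] L) : L →+* L) g (t • H) = Matrix.diagonal dV)
    (hpos : ∀ τ' : L →+* ℂ, InfinitePlace.mk τ' ≠ InfinitePlace.mk ι → ((Matrix.diagonal dV).map τ').PosDef)
    (h4L : 4 ≤ finrank ℚ L) :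
    ∀ x : Fin 2 → L, hermForm (cmConjRingHom L) H x x = 0 → x = 0 := by
  obtain ⟨τ', hτ'⟩ := exists_embedding_mk_ne L h4L ι
  have hD := anisotropic_of_posDef_map L (Matrix.diagonal dV) τ' (hpos τ' hτ')
  have hg' : formCongr (cmConjRingHom L) g (t • H) = Matrix.diagonal dV := hg
  rw [← hg'] at hD
  exact anisotropic_of_anisotropic_smul L t (anisotropic_of_anisotropic_formCongr L g hD)

end Summit.HodgeConjecture.HodgeConjecture.Cruxes.HLiu418.K2LiuDoublingZetaGL1Anisotropic

end
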